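import Literature.NumberTheory.Sieve.MoebiusExpSumDavenport
import Literature.Analysis.FunctionSpaces.WeakCompactnessL1Proofs

/-!
# Route `GreenTaoLevelTwo`, crux `MNTwo` (stmt-Parity-21276), line `birth`, stub `stub_mnVertical`:
# soft-thresholding a Lipschitz function (GT 2008b App. A, Lemma 41)

Brick for block V3 (§8, "Locally quadratic phase functions, I: a technical reduction") of the
`stub_mnVertical` census (B. Green, T. Tao, *Quadratic uniformity of the Möbius function*,
Ann. Inst. Fourier 58 (2008) = arXiv:math/0606087, Appendix A "Some harmonic analysis tools",
Lemma 41 "Soft-thresholding a Lipschitz function": for `F : X → [-1,1]` Lipschitz and `δ > 0` the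
function `F̃(x) := max(|F(x)| − λ, 0) sgn(F(x))`, `λ := δ‖F‖_Lip`, satisfies (i) `‖F̃‖_Lip ≤ ‖F‖_Lip`,
(ii) `x ∈ Supp F̃`, `d(x,x') ≤ δ ⇒ x' ∈ Supp F`, (iii) `‖F − F̃‖_∞ ≤ δ‖F‖_Lip`).

Def-free: the soft threshold at level `l ≥ 0` is written as `u − max (−l) (min l u)` (`u` minus its
clamp to `[−l, l]`, which equals `max(|u| − l, 0) sgn u`).  Scalar facts (`§1`) and their lifts to a
function `F : Y → ℝ` on an arbitrary type with an arbitrary "distance" `d : Y → Y → ℝ` (`§2`):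

* `abs_sub_softThreshold_le` — `|u − ũ| ≤ l` (Lemma 41 (iii); the clamp bound itself is the tree's
  `Literature.Analysis.FunctionSpaces.abs_max_neg_min_le`, and `|ũ| ≤ |u|` is
  `Literature.Analysis.FunctionSpaces.abs_sub_max_neg_min_le`);
* `abs_softThreshold_sub_softThreshold_le` — `|ũ − ṽ| ≤ |u − v|` (the map is a contraction,
  Lemma 41 (i));
* `lt_abs_of_softThreshold_ne_zero`, `ne_zero_of_softThreshold_ne_zero` — `ũ ≠ 0 ⇒ l < |u|`, hence
  `|u − u'| ≤ l ⇒ u' ≠ 0` (Lemma 41 (ii));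
* `softThreshold_lipschitz`, `softThreshold_bound`, `softThreshold_close`, `softThreshold_support`
  — the same for `F̃ := fun y ↦ F y − max (−l) (min l (F y))`.

References: [GreenTao2008QuadraticMobius] arXiv:math/0606087, Appendix A, Lemma 41.
-/

noncomputable section

namespace Summit.Parity.GeneralizedHardyLittlewood.GreenTaoLevelTwoMNTwoSoftThreshold

open Literature.Analysis.FunctionSpaces (abs_max_neg_min_le abs_sub_max_neg_min_le)

/-! ### §1 The scalar soft threshold `u ↦ u − max (−l) (min l u)` -/

/-- Lemma 41 (iii), scalar form: `|u − ũ| ≤ l` where `ũ = u − max (−l) (min l u)`.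
[cite: GreenTao2008QuadraticMobius, App. A, Lemma 41 (iii)] -/
theorem abs_sub_softThreshold_le {l : ℝ} (hl : 0 ≤ l) (u : ℝ) :
    |u - (u - max (-l) (min l u))| ≤ l := by
  rw [sub_sub_cancel]
  exact abs_max_neg_min_le hl u

/-- Lemma 41 (i), scalar form: the soft threshold is a contraction,
`|ũ − ṽ| ≤ |u − v|`. [cite: GreenTao2008QuadraticMobius, App. A, Lemma 41 (i)] -/
theorem abs_softThreshold_sub_softThreshold_le {l : ℝ} (hl : 0 ≤ l) (u v : ℝ) :
    |(u - max (-l) (min l u)) - (v - max (-l) (min l v))| ≤ |u - v| := by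
  rcases le_total u v with huv | huv
  · -- `u ≤ v`: both differences are nonpositive and the clamp moves less than the identity
    have h1 : max (-l) (min l u) ≤ max (-l) (min l v) :=
      max_le_max le_rfl (min_le_min le_rfl huv)
    have h2 : max (-l) (min l v) - max (-l) (min l u) ≤ v - u := by
      simp only [max_def, min_def]
      split_ifs <;> linarith
    rw [abs_of_nonpos (by linarith), abs_of_nonpos (by linarith)]
    linarith
  · have h1 : max (-l) (min l v) ≤ max (-l) (min l u) :=
      max_le_max le_rfl (min_le_min le_rfl huv)
    have h2 : max (-l) (min l u) - max (-l) (min l v) ≤ u - v := by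
      simp only [max_def, min_def]
      split_ifs <;> linarith
    rw [abs_of_nonneg (by linarith), abs_of_nonneg (by linarith)]
    linarith

/-- Lemma 41 (ii), scalar form: if `ũ ≠ 0` then `l < |u|`.
[cite: GreenTao2008QuadraticMobius, App. A, Lemma 41 (ii)] -/
theorem lt_abs_of_softThreshold_ne_zero {l : ℝ} {u : ℝ}
    (h : u - max (-l) (min l u) ≠ 0) : l < |u| := by
  by_contra hcon
  push Not at hcon
  rw [abs_le] at hcon
  apply h
  rw [min_eq_right hcon.2, max_eq_right hcon.1, sub_self]

/-- Lemma 41 (ii), scalar support form: if `ũ ≠ 0` and `|u − u'| ≤ l` then `u' ≠ 0`.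
[cite: GreenTao2008QuadraticMobius, App. A, Lemma 41 (ii), eq. (boxeq)] -/
theorem ne_zero_of_softThreshold_ne_zero {l : ℝ} {u u' : ℝ}
    (h : u - max (-l) (min l u) ≠ 0) (hclose : |u - u'| ≤ l) : u' ≠ 0 := by
  have hlt := lt_abs_of_softThreshold_ne_zero h
  intro hu'
  rw [hu', sub_zero] at hclose
  linarith

/-! ### §2 The soft threshold of a function -/

/-- Lemma 41 (i): soft-thresholding does not increase a Lipschitz bound — for ANY "distance-like"
`d`, if `|F y − F y'| ≤ M d y y'` then the same holds for `F̃ := fun y ↦ F y − max (−l) (min l (F y))`.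
[cite: GreenTao2008QuadraticMobius, App. A, Lemma 41 (i)] -/
theorem softThreshold_lipschitz {Y : Type*} {F : Y → ℝ} {d : Y → Y → ℝ} {M l : ℝ} (hl : 0 ≤ l)
    (hF : ∀ y y', |F y - F y'| ≤ M * d y y') (y y' : Y) :
    |(F y - max (-l) (min l (F y))) - (F y' - max (-l) (min l (F y')))| ≤ M * d y y' :=
  (abs_softThreshold_sub_softThreshold_le hl _ _).trans (hF y y')

/-- `|F̃ y| ≤ |F y|`; in particular `F̃` is `1`-bounded when `F` is. [folklore] -/
theorem softThreshold_bound {Y : Type*} {F : Y → ℝ} {l : ℝ} (hl : 0 ≤ l)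
    (hF : ∀ y, |F y| ≤ 1) (y : Y) : |F y - max (-l) (min l (F y))| ≤ 1 :=
  (abs_sub_max_neg_min_le hl _).trans (hF y)

/-- Lemma 41 (iii): `‖F − F̃‖_∞ ≤ l`. [cite: GreenTao2008QuadraticMobius, App. A, Lemma 41 (iii)] -/
theorem softThreshold_close {Y : Type*} (F : Y → ℝ) {l : ℝ} (hl : 0 ≤ l) (y : Y) :
    |F y - (F y - max (-l) (min l (F y)))| ≤ l :=
  abs_sub_softThreshold_le hl _

/-- Lemma 41 (ii): if `y ∈ Supp F̃` and `M d(y, y') ≤ l` then `y' ∈ Supp F`.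
[cite: GreenTao2008QuadraticMobius, App. A, Lemma 41 (ii)] -/
theorem softThreshold_support {Y : Type*} {F : Y → ℝ} {d : Y → Y → ℝ} {M l : ℝ}
    (hF : ∀ y y', |F y - F y'| ≤ M * d y y') {y y' : Y}
    (hy : F y - max (-l) (min l (F y)) ≠ 0) (hd : M * d y y' ≤ l) : F y' ≠ 0 :=
  ne_zero_of_softThreshold_ne_zero hy ((hF y y').trans hd)

end Summit.Parity.GeneralizedHardyLittlewood.GreenTaoLevelTwoMNTwoSoftThreshold
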